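import Literature.IUT.HodgeArakelov.ThetaSettingDeltaCharacteristicAtModelTateDischarge
import Literature.IUT.HodgeTheaters.ProfiniteCompletionRestrictOpen
import Literature.AnabelianGeometry.SemiGraphs.TemperedCompletionExistence
import Literature.AnabelianGeometry.SemiGraphs.TemperedCompletionOpenSubgroups
import HarnessLib

/-!
# «(ii-b)-IDENT»: the geometric part `Δ_E` of THE completion package of `Π^tp_{X̲̲}` at the stage-2 [EtTh] Tate model IS
# (as a topological group) an open subgroup of `F̂₂` — hence (H1) at the model ⟸ {`Ker (tatePairHom) ≠ ⊥`} ALONE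

S. Mochizuki, *Semi-graphs of anabelioids*, Publ. RIMS **42** (2006) [SemiAnbd], §6 p. 69 ("`Π_{X_K} := (Π^temp_{X_K})^∧`; `Δ_X :=
(Δ^temp_X)^∧`", THE profinite completion; p. 73 "profinite completion, or, EQUIVALENTLY, closure in `Π_{X_K}`")
[cite: MochizukiSemiAnbd2006, §6 p.69]; [EtTh] §1 p. 12 ("`Δ_X` … a profinite free group on 2 generators")
[cite: MochizukiEtTh2009, §1 p.12]; [IUTchII] §1 Ex. 1.8 (i) (kurims p. 35) [claim: Mochizuki2012, status: disputed].

Cell `abc-iut`, seat abc-iut-w4-d044 (gen 7), row W1 «MCHAR-VIA-PROJECTIVITY (ii-b)», re-slice «(ii-b)-IDENT» (abc-iut-L6-lead §F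
01:42:03Z; basename approved).  PROOF-ONLY, 0 defs / instances / named facts.  ROUTE (no new `Δ`-level completion theorem):
UNIQUENESS OF PROFINITE COMPLETIONS AT THE `Π`-LEVEL — both `ι := S.completionMap : Π^{(S)} → Π_E` (abc-iut-w5-d233's named package)
and the restriction of the model's `toHat : Π^tp_X → Π_X = F̂₂ ⋊ G_{ℚ_p}` to the open finite-index `Π^{(S)} = C.Huu`, with target the
closure `Ĥ` of its image (a profinite completion by abc-iut-L5-t11's `ProfiniteCompletionRestrict.isProfiniteCompletion_restrict'`), are
profinite completions of `Π^{(S)}`; abc-iut-L2-d1's `IsProfiniteCompletion.nonempty_continuousMulEquiv` gives `e : Π_E ≃ₜ* Ĥ` over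
`Π^{(S)}`; the `G_{ℚ_p}`-component of `e` agrees with `aug_E` on the dense image, hence everywhere; so `e` carries
`Δ_E = Ker aug_E` onto `Ĥ ∩ (F̂₂ ⋊ 1)`, i.e. onto the OPEN subgroup `U := inl⁻¹(Ĥ)` of `F̂₂` (`Ĥ` is open:
`IsProfiniteCompletion.isOpen_topologicalClosure_map`).

WHAT IS SHOWN (`D := modelχq p i j`, ANY `X̲̲`-choice `C`, `S := ThetaSetting.ofDoubleUnderline C μ …`,
`E := S.completionPackage D.K D.galoisIdentification`):
* `SettingModel.exists_geom_completionPackage_equiv_isOpen` — **`∃ U ≤ F̂₂` open, `Nonempty (Δ_E ≃ₜ* U)`**;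
* `SettingModel.deltaX_characteristic_ofDoubleUnderline_modelχq_of_ker_ne_bot'` /
  **`SettingModel.deltaX_characteristic_setting_modelχq_of_ker_ne_bot'`** — (H1) «every automorphism of topological groups of
  `Π^{(S)}` carries `Δ^{(S)}` onto itself» at `S` / at `EtaleLevels.setting C … mods f hf` (the `hΔX` binder of p477403) modulo
  EXACTLY **`hI0 : Ker (tatePairHom p i j) ≠ ⊥`** («the Tate character pair is not injective on `G_{ℚ_p}`», classical) — the
  identification binder `eΔ` of file B (p485127/p485565) DISCHARGED here.

HONEST FRAMING: `modelχq` is a SEMI-SYNTHETIC model (binder-discharge / joint-satisfiability evidence for OUR typed interface); classical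
topological group theory over the tree's `IsProfiniteCompletion` API; nothing here bears on [IUTchIII] Cor. 3.12 or takes a side;
typed ≠ proved elsewhere; instantiated ≠ endorsed; nothing asserts abc proved or refuted.
-/

noncomputable section

namespace Literature.AnabelianGeometry.EtaleTheta.SettingModel

open Literature.AnabelianGeometry.AbsoluteAnabelian
open Literature.AnabelianGeometry.SemiGraphs
open Literature.IUT.HodgeTheaters (profiniteCompletion)
open Literature.IUT.HodgeArakelov

variable (p : ℕ) [Fact p.Prime] (i j : ℤ) (hj : Even j)

section Model

variable {ED : (ThetaSetting.modelχq p i j hj).EtaleThetaData} {l : ℕ} (C : ED.DoubleUnderline l) {N : ℕ+}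
  (μ : (ThetaSetting.modelχq p i j hj).CyclotomeMod l N) (hC : (ThetaSetting.modelχq p i j hj).Compat)
  (hS : (ThetaSetting.modelχq p i j hj).Sec2Hyps) (hl : l.Prime) (hp2 : p ≠ 2) (hpl : p ≠ l)
  (hζ : ∃ ζ : (ThetaSetting.modelχq p i j hj).K, IsPrimitiveRoot ζ (4 * l))
  {η : (C.thetaEnvData μ hC hS).PiYdd → MuN p N} (hη : η ∈ (C.thetaEnvData μ hC hS).thetaCocycles)

/-- **«(ii-b)-IDENT»: `Δ_E ≃ₜ* U` for an OPEN subgroup `U ≤ F̂₂`**, where `E` is THE completion package of the [IUTchII] §1 setting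
`S = ofDoubleUnderline C μ …` of the stage-2 model and `U := inl⁻¹(Ĥ)`, `Ĥ :=` the closure of `toHat(C.Huu)` in `Π_X = F̂₂ ⋊ G_{ℚ_p}`
(uniqueness of profinite completions at the `Π`-level; see the module docstring). [cite: MochizukiSemiAnbd2006, §6 p.69] -/
theorem exists_geom_completionPackage_equiv_isOpen :
    ∃ (U : Subgroup (profiniteCompletion (FreeGroup (Fin 2)))) (_ : IsOpen (U : Set (profiniteCompletion (FreeGroup (Fin 2))))),
      Nonempty (((ThetaSetting.ofDoubleUnderline C μ hC hS hl hp2 hpl hζ hη).completionPackage (ThetaSetting.modelχq p i j hj).K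
        (ThetaSetting.modelχq p i j hj).toTemperedCurve.galoisIdentification).geom ≃ₜ* U) := by
  classical
  haveI : IsGalois ℚ_[p] (AlgebraicClosure ℚ_[p]) := {}
  haveI : T2Space (GQp p) := krullTopology_t2
  -- notation
  set S := ThetaSetting.ofDoubleUnderline C μ hC hS hl hp2 hpl hζ hη with hSdef
  set eK := (ThetaSetting.modelχq p i j hj).toTemperedCurve.galoisIdentification with heKdef
  set E := S.completionPackage (ThetaSetting.modelχq p i j hj).K eK with hEdef
  -- `C.Huu ≤ Π^tp_X` is open of finite index `l²`
  haveI hfi : C.Huu.FiniteIndex :=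
    Subgroup.finiteIndex_iff.2 (by rw [C.index_Huu]; exact pow_ne_zero _ C.l_ne_zero)
  have hX : IsProfiniteCompletion (toHatχq p i j) := isProfiniteCompletion_toHatχq p i j
  -- `Ĥ` := the closure of `toHat(C.Huu)` in `Π_X`, open
  set H : Subgroup (PiHtχq p i j) := (C.Huu.map (toHatχq p i j).toMonoidHom).topologicalClosure with hHdef
  have hHopen : IsOpen (H : Set (PiHtχq p i j)) :=
    IsProfiniteCompletion.isOpen_topologicalClosure_map hX C.Huu C.isOpen_Huu
  -- `ιH : C.Huu → Ĥ`, a profinite completion of `Π^{(S)} = C.Huu`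
  let ιH : S.PiX →ₜ* H :=
    { toFun := fun x => ⟨toHatχq p i j (Subtype.val x), Subgroup.le_topologicalClosure _ ⟨_, x.2, rfl⟩⟩
      map_one' := Subtype.ext (by
        change toHatχq p i j (1 : PiTpχq p i j) = 1
        exact map_one _)
      map_mul' := fun a b => Subtype.ext (by
        change toHatχq p i j ((Subtype.val a : PiTpχq p i j) * Subtype.val b) = _
        exact map_mul _ _ _)
      continuous_toFun := ((toHatχq p i j).continuous.comp continuous_subtype_val).subtype_mk _ }
  have hιH_apply : ∀ x : S.PiX, ((ιH x : H) : PiHtχq p i j) = toHatχq p i j (Subtype.val x) := fun _ => rfl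
  have hιH : IsProfiniteCompletion ιH :=
    Literature.IUT.HodgeTheaters.ProfiniteCompletionRestrict.isProfiniteCompletion_restrict' hX C.Huu C.isOpen_Huu ιH
      fun _ => rfl
  -- uniqueness: `e : Π_E ≃ₜ* Ĥ` over `Π^{(S)}`
  obtain ⟨e, he⟩ := IsProfiniteCompletion.nonempty_continuousMulEquiv S.isProfiniteCompletion_completionMap hιH
  -- the `G_{ℚ_p}`-component of `e` is `aug_E` (read in `G_{ℚ_p}`): agree on the dense image of `Π^{(S)}`
  have hright : ∀ z : S.completionArith,
      ((e z : H) : PiHtχq p i j).right = ((eK.symm (E.aug z) : (ThetaSetting.modelχq p i j hj).GK) : GQp p) := by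
    have h1 : Continuous fun z : S.completionArith => ((e z : H) : PiHtχq p i j).right :=
      (Semidirect.continuous_right (isInducing_leftRightHatχq p i j)).comp (continuous_subtype_val.comp e.continuous)
    have h2 : Continuous fun z : S.completionArith =>
        ((eK.symm (E.aug z) : (ThetaSetting.modelχq p i j hj).GK) : GQp p) :=
      continuous_subtype_val.comp (eK.symm.continuous.comp E.aug.continuous)
    have heq := S.isProfiniteCompletion_completionMap.denseRange.equalizer h1 h2 (by
      funext g
      change ((e (S.completionMap g) : H) : PiHtχq p i j).right =
        ((eK.symm (E.aug (S.completionMap g)) : (ThetaSetting.modelχq p i j hj).GK) : GQp p)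
      have h3 : eK.symm (E.aug (S.completionMap g)) = S.aug g := eK.injective (by
        rw [ContinuousMulEquiv.apply_symm_apply]
        exact S.completionAug_completionMap _ eK g)
      rw [he g, hιH_apply, toHatχq_right, h3]
      rfl)
    exact fun z => congrFun heq z
  -- on `Δ_E = Ker aug_E` the `G_{ℚ_p}`-component of `e` is trivial
  have hright1 : ∀ z : S.completionArith, z ∈ E.geom → ((e z : H) : PiHtχq p i j).right = 1 := by
    intro z hz
    rw [hright z, (FundamentalExtension.mem_geom E).mp hz, map_one]
    rfl
  have hinl : ∀ z : S.completionArith, z ∈ E.geom →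
      SemidirectProduct.inl ((e z : H) : PiHtχq p i j).left = ((e z : H) : PiHtχq p i j) := by
    intro z hz
    conv_rhs => rw [← SemidirectProduct.inl_left_mul_inr_right ((e z : H) : PiHtχq p i j)]
    rw [hright1 z hz, map_one, mul_one]
  -- the open subgroup `U := inl⁻¹(Ĥ)` of `F̂₂`
  let U : Subgroup (profiniteCompletion (FreeGroup (Fin 2))) :=
    H.comap (SemidirectProduct.inl : F₂hatT →* PiHtχq p i j)
  have hU : IsOpen (U : Set (profiniteCompletion (FreeGroup (Fin 2)))) :=
    hHopen.preimage (Semidirect.continuous_inl (isInducing_leftRightHatχq p i j))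
  refine ⟨U, hU, ⟨?_⟩⟩
  -- membership of the two candidate maps
  have hto : ∀ z : E.geom, ((e (z : S.completionArith) : H) : PiHtχq p i j).left ∈ U := by
    intro z
    change SemidirectProduct.inl _ ∈ H
    rw [hinl _ z.2]
    exact (e (z : S.completionArith)).2
  have haug1 : ∀ u : U, E.aug (e.symm ⟨SemidirectProduct.inl (u : F₂hatT), u.2⟩) = 1 := by
    intro u
    have h := hright (e.symm ⟨SemidirectProduct.inl (u : F₂hatT), u.2⟩)
    rw [ContinuousMulEquiv.apply_symm_apply] at h
    change (SemidirectProduct.inl (u : F₂hatT) : PiHtχq p i j).right = _ at h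
    rw [SemidirectProduct.right_inl] at h
    have h' : eK.symm (E.aug (e.symm ⟨SemidirectProduct.inl (u : F₂hatT), u.2⟩)) = 1 :=
      Subtype.ext h.symm
    rw [← eK.apply_symm_apply (E.aug _), h', map_one]
  have hinv : ∀ u : U, e.symm ⟨SemidirectProduct.inl (u : F₂hatT), u.2⟩ ∈ E.geom :=
    fun u => (FundamentalExtension.mem_geom E).mpr (haug1 u)
  exact
    { toFun := fun z => ⟨((e (z : S.completionArith) : H) : PiHtχq p i j).left, hto z⟩
      invFun := fun u => ⟨e.symm ⟨SemidirectProduct.inl (u : F₂hatT), u.2⟩, hinv u⟩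
      left_inv := fun z => by
        apply Subtype.ext
        change e.symm ⟨SemidirectProduct.inl ((e (z : S.completionArith) : H) : PiHtχq p i j).left, _⟩ = (z : S.completionArith)
        have : (⟨SemidirectProduct.inl ((e (z : S.completionArith) : H) : PiHtχq p i j).left, hto z⟩ : H) =
            e (z : S.completionArith) := Subtype.ext (hinl _ z.2)
        rw [this, ContinuousMulEquiv.symm_apply_apply]
      right_inv := fun u => by
        apply Subtype.ext
        change ((e (e.symm ⟨SemidirectProduct.inl (u : F₂hatT), u.2⟩) : H) : PiHtχq p i j).left = (u : F₂hatT)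
        rw [ContinuousMulEquiv.apply_symm_apply]
        rfl
      map_mul' := fun a b => by
        apply Subtype.ext
        change ((e ((a : S.completionArith) * b) : H) : PiHtχq p i j).left =
          ((e (a : S.completionArith) : H) : PiHtχq p i j).left * ((e (b : S.completionArith) : H) : PiHtχq p i j).left
        rw [map_mul, Subgroup.coe_mul, SemidirectProduct.mul_left, hright1 _ a.2, map_one, MulAut.one_apply]
      continuous_toFun := by
        apply Continuous.subtype_mk
        exact (Semidirect.continuous_left (isInducing_leftRightHatχq p i j)).comp
          (continuous_subtype_val.comp (e.continuous.comp continuous_subtype_val))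
      continuous_invFun := by
        apply Continuous.subtype_mk
        exact e.symm.continuous.comp
          (((Semidirect.continuous_inl (isInducing_leftRightHatχq p i j)).comp continuous_subtype_val).subtype_mk _) }

/-- **(H1) AT THE STAGE-2 MODEL modulo `hI0 : Ker (tatePairHom) ≠ ⊥` ALONE** (file B's `eΔ` binder discharged by the identification
above): for every `X̲̲`-choice `C` over `modelχq p i j` and `S := ofDoubleUnderline C μ …`, every automorphism of topological groups
of `Π^{(S)}` carries `Δ^{(S)}` onto itself. [claim: Mochizuki2012, status: disputed] (IUTchII §1 Ex 1.8 (i), kurims p.35)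
[cite: MochizukiAbsTopI2012, Thm 2.6 (v) p.22] -/
theorem deltaX_characteristic_ofDoubleUnderline_modelχq_of_ker_ne_bot' (hI0 : (tatePairHom p i j).ker ≠ ⊥) :
    ∀ φ : (ThetaSetting.ofDoubleUnderline C μ hC hS hl hp2 hpl hζ hη).PiX ≃ₜ*
        (ThetaSetting.ofDoubleUnderline C μ hC hS hl hp2 hpl hζ hη).PiX,
      (ThetaSetting.ofDoubleUnderline C μ hC hS hl hp2 hpl hζ hη).DeltaX.map φ.toMulEquiv.toMonoidHom =
        (ThetaSetting.ofDoubleUnderline C μ hC hS hl hp2 hpl hζ hη).DeltaX := by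
  obtain ⟨U, hU, ⟨eΔ⟩⟩ := exists_geom_completionPackage_equiv_isOpen p i j hj C μ hC hS hl hp2 hpl hζ hη
  exact deltaX_characteristic_ofDoubleUnderline_modelχq_of_ker_ne_bot p i j hj C μ hC hS hl hp2 hpl hζ hη hI0 U hU eΔ

/-- **The `hΔX` binder of the Cor. 1.12 (ii)(iii) instance of record p477403 modulo `hI0` ALONE**: (H1) at
`EtaleLevels.setting C hC hS hl hp2 hpl hζ mods f hf` over `modelχq p i j` from «`Ker (tatePairHom p i j) ≠ ⊥`».  K-L6: the custody
input (H1)/MChar at the Tate model is now «⟸ {hI0}», one classical local-field statement.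
[claim: Mochizuki2012, status: disputed] (IUTchII §1 Ex 1.8 (i), kurims p.35) [cite: MochizukiAbsTopI2012, Thm 2.6 (v) p.22] -/
theorem deltaX_characteristic_setting_modelχq_of_ker_ne_bot' (mods : ∀ M : ℕ+, (ThetaSetting.modelχq p i j hj).CyclotomeMod l M)
    (f : _) (hf : f ∈ C.rootCocycles hC) (hI0 : (tatePairHom p i j).ker ≠ ⊥) :
    ∀ φ : (EtaleLevels.setting C hC hS hl hp2 hpl hζ mods f hf).PiX ≃ₜ* (EtaleLevels.setting C hC hS hl hp2 hpl hζ mods f hf).PiX,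
      (EtaleLevels.setting C hC hS hl hp2 hpl hζ mods f hf).DeltaX.map φ.toMulEquiv.toMonoidHom =
        (EtaleLevels.setting C hC hS hl hp2 hpl hζ mods f hf).DeltaX :=
  deltaX_characteristic_ofDoubleUnderline_modelχq_of_ker_ne_bot' p i j hj C (mods 1) hC hS hl hp2 hpl hζ
    (EtaleLevels.eta0_mem C hC hS mods f hf 1) hI0

end Model

end Literature.AnabelianGeometry.EtaleTheta.SettingModel

end
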